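import Literature.MathematicalPhysics.QuantumFieldTheory.Balaban1983to89.B4Thm110ZeroBoxDeriv
import Literature.MathematicalPhysics.QuantumFieldTheory.Balaban1983to89.B3Sect2StatementsPart2

/-!
# `Balaban1983to89.B3Ineq210ZeroBox` — T. Bałaban, *(Higgs)₂,₃ quantum fields in a finite volume. III. Renormalization*,
# Commun. Math. Phys. **88** (1983) 411–445 [Balaban1983Higgs3]: the propagator bound (2.10) p. 426 on the scale pieces
# `G^η_{(j)}` of the decomposition (2.6) p. 424, PROVED for the MODEL INSTANCE `A = B̃ = 0`, `Ω = □` a rectangular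
# parallelepiped, every scale `k ≥ 1` — `B3Sect2StatementsPart2.ScaledKernels.Ineq210 δ₁ C` DISCHARGED for the concrete carrier

statement-level skeleton of published theorems with citation tags; proofs where landed; nothing here is a claim about the Yang–Mills mass gap

PDF held: `paper:balaban1983-higgs-2-3-quantum-fields-finite-volume` (journal page = PDF page + 410); p. 424 [PDF 14] (2.5)–(2.6) and
p. 426 [PDF 16] (2.10)–(2.12) read on the renders `run/shared/lean/pub/pub-balaban/b2b-balaban-ref1/pages/1983-cmp88-higgs23-III/
1983-cmp88-higgs23-III-p014-x2.png`, `-p016-x2.png`; [B4] = T. Bałaban, *Regularity and decay of lattice Green's functions*, Commun.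
Math. Phys. **89** (1983) 571–597 [Balaban1983RegularityDecay], pp. 582–583 [PDF 12–13] (2.34)–(2.39) and the Remark of p. 583, as
quoted in the headers of `B4Thm110ZeroBox` / `B4Thm110ZeroBoxDeriv`.

CITATION HEADER (lean-in-tree rule).  Part of the lit-balaban TYPED SKELETON (HOME `run/shared/lean/pub/lit-balaban/`), Phase 2:
SKELETON row **B3.Eq2.10** (`HOME/lit-balaban-r15/ROWS-B3.md`, fold owner r15; decl of record `B3Sect2StatementsPart2.ScaledKernels.Ineq210`,
typed p239134 over the ABSTRACT carrier `ScaledKernels`).  WHAT IS PRINTED (p. 424, (2.6)): *"Our first step in the proof of the theorem is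
to write the expression … as a sum obtained by decomposing all the propagators corresponding to the lines of G′ according to the equality
G_k(Ω, B̃) = C^{(0),η}(Ω, B̃) + Σ_{j=1}^{k−1} a_j²(L^jη)^{−4}G^η_j(Ω, B̃)Q_j^*(B̃)C^{(j),L^jη}(Ω, B̃)Q_j(B̃)G^η_j(Ω, B̃) = Σ_{j=0}^{k−1} G^η_{(j)}(Ω, B̃), (2.6)"*;
(p. 426, (2.10)): *"For the propagators G^η_{(j)} we apply the inequality |G^η_{(j)}(Ω, B̃; x, x′)| ≤ O(1)(L^jη)^{−d+2}e^{−δ₁(L^jη)^{−1}|x−x′|},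
(2.10) and if the propagator is differentiated, then for each differentiation, there is an additional factor (L^jη)^{−1} on the right
side. … These inequalities will be used in the next chapter. They all are obtained by rescaling from the η-lattice to the L^{−j}-lattice
and application of Propositions I.2.1 and I.2.3."* ([Balaban1982Higgs1] Props. 2.1/2.3 = [B4] Theorem p. 573 / Prop. 2.3 p. 574); [B4]
p. 583, Remark: *"Let us mention here that the above method can be used also to prove pointwise estimates of G_k(□), G_k(□, A), and even
G_k(Ω, A), their derivatives and "Hölder-derivatives"."*

WHAT IS REPRODUCED, and how (kind «model-instance», G.1 of `HOME/PHASE2-TARGETS.md`).  The typed Prop `ScaledKernels.Ineq210 δ₁ C` quantifies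
over ABSTRACT carrier data (the kernels `absG`, `absDG` are fields of `ScaledKernels`); it is proved here for the CONCRETE carrier
`zeroBoxKernels ℓ k hℓ M a m2` (§5) of the model instance
* `A = B̃ = 0` (so `U ≡ 1`, one field component, the covariant derivative is the plain forward difference), `Ω = □ = Π_μ[0, M_μ)` a
  rectangular parallelepiped of unit blocks with Neumann conditions (print: `Ω ⊂ T_η` a union of big blocks — the box is the case [B4]
  treats «without any restrictions on the points x, x′», p. 573), dimension `d + 1 ≥ 1`, `L = ℓ + 1 ≥ 2`, EVERY scale `k ≥ 1` (`η = L^{−k}`),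
  the running constants in a window `a ∈ [a₋, a₊]` (`a₋ > 0`), `m² ∈ [0, m²₊]`;
* the fine lattice `□ ∩ ηℤ^{d+1}` in lattice units = `B4Reflection242.boxDom (L^k·M)`, the scale-`j` propagators `G^η_j(□) = 𝒢_j =
  B4Thm110ZeroBox.Gfine` (values/counting normalisation), `Q_j, Q_j^*` = `QkM`/`QksM`, `C^{(j),L^jη}(□)` = `Cmat` (= `(L^jη)²·(B4BoxCov237.covOp …)⁻¹`),
  `a_j = B1.aSeq a L j`; the SCALE PIECES of (2.6) are `piece j` (§2): `G^η_{(0)} = C^{(0),η}(□) = 𝒢_1`, `G^η_{(j)} = 𝒢_{j+1} − 𝒢_j =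
  α_j²·(𝒢_jQ_j^*)·C_j·(Q_j𝒢_j)` for `1 ≤ j ≤ k − 1` ([B4] (2.34) one step at a time = `B4Thm110ZeroBox.Gfine_succ_sub`, i.e. [Balaban1982Higgs1]
  (2.42)–(2.43) `B1RG242.StepData.display242` on the box), none for `j ≥ k`; **(2.6) for the instance is PROVED** (`sum_piece`,
  `sum_piece_eq_inv`: `Σ_{j<k} G^η_{(j)} = G_k(□, 0) = (−Δ^{η,N}_□ + m² + a_kP_k)^{−1} = (B4BoxCov237.boxOpR (L^k) a_k m² M)⁻¹`);
* **(2.10), VALUE CLAUSE** (§3, `abs_piece_le`, counting normalisation): `|G^η_{(j)}(x,x′)| ≤ C·L^{−j(d+1)}·(L^jη)²·e^{−δ₁|x−x′|_∞/L^j}`, i.e.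
  `η^{d+1}`·(the printed `O(1)(L^jη)^{−(d+1)+2}e^{−δ₁(L^jη)^{−1}|x−x′|}`), from the kernel-proved block-row form of [B4] (2.35)
  (`B4Thm110ZeroBox.Gfine_blockRow_bound`), [B4] (2.37) (`B4BoxCov237.cov237_box_decay`), the one-step base (`B4Thm110ZeroBox.boxOpR_L_inv_decay`)
  and a POINTWISE triple-product estimate (§1, `Σ_{y,y′}e^{−κ|β_x−y|}e^{−δ|y−y′|}e^{−κ|y′−β_{x′}|} ≤ K(κ/2)K(δ/2)e^{−(min(κ,δ)/2)|β_x−β_{x′}|}` — the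
  pointwise twin of the weighted-row bookkeeping of `B4Thm110ZeroBox.step_term_bound`, as announced by the Remark of [B4] p. 583);
* **(2.10), DERIVATIVE CLAUSE** («an additional factor (L^jη)^{−1}», §4, `abs_pieceDiff_le`): `η^{−1}|G^η_{(j)}(x+ηe_μ,x′) − G^η_{(j)}(x,x′)| ≤
  C·L^{−j(d+1)}·(L^jη)·e^{−δ₁|x−x′|_∞/L^j}` from the DERIVATIVE block-row form of [B4] (2.35) (`B4Thm110ZeroBoxDeriv.Gfine_blockRowDiff_bound`,
  kernel-proved in `B4Green242Bridge`) — one factor `(L^jη)` instead of `(L^jη)²`, exactly the printed gain; at `j = 0` (`L^0η = η`) nothing is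
  to be gained and the one-step Green's function is differenced crudely;
* **`ineq210_zeroBox`** (§5): `∃ δ₁ > 0, C > 0` (depending on `d`, `L` and the window only) such that `(zeroBoxKernels ℓ k hℓ M a m2).Ineq210 δ₁ C`
  for every `k ≥ 1`, every window point and every box — with `absG j x x′ = η^{−(d+1)}|G^η_{(j)}(x,x′)|` and `absDG j μ x x′ =
  η^{−(d+1)}·η^{−1}|G^η_{(j)}(x+ηe_μ,x′) − G^η_{(j)}(x,x′)|` the kernels in the PRINT'S `η^d`-normalisation (`(Gf)(x) = Σ_{x′}η^dG(x,x′)f(x′)`),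
  `dist(x,x′) = η|x−x′|_∞`, `scale j = L^jη`; §6 a non-vacuity witness (`d + 1 = 3`, `L = 2`, `k = 1`, unit cube).

HONEST SCOPE / DECLARED DIVERGENCES (F7).  (i) Only `A = B̃ = 0` and `Ω = □` a box (the print: general `Ω`, `B̃` regular) — the general case is
the content of [B4]'s Theorem/Prop. 2.3 for `A ≠ 0` (rows B1.Prop2.1/B1.Prop2.3, typed, NOT proved in the tree) and is NOT claimed; not the torus.
(ii) The derivative is the forward difference in the ROW variable along bonds `⟨x, x+ηe_μ⟩ ⊂ □` (both end-points in the box, (1.3) of [B4]);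
`absDG` is `0` on the missing bonds of the Neumann box.  (iii) `|x − x′|` is the sup norm in lattice units times `η` (Euclidean `≥` sup: the
printed form follows with `δ₁/√(d+1)`).  (iv) Constants are existential and depend on `d`, `L` and the WINDOW (print: O(1), δ₁ «positive
constants»; silent `L`-dependence).  (v) ONLY (2.10) is modelled: the carrier fields entering (2.5), (2.11), (2.12) (`Bond`, `LocFn`, `dist2`,
`distBlock`, `distSupp`, `distΩ₂`, `eRun`, `pRun`, `holderDiff`, `absGavg`, `normDeltaG`, `norm116`) are set to `Unit`/`0` and NOTHING is claimed
about `Ineq25`/`Ineq211`/`Ineq212` of this instance.  (vi) ROUTE = the print's own («rescaling … and application of Propositions I.2.1 and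
I.2.3»), through the kernel-proved `A = 0` box forms of [B4] (2.34)/(2.35)/(2.37) of the pub-balaban lineage (`B4Thm110ZeroBox`,
`B4Thm110ZeroBoxDeriv`, `B4BoxCov237`, used BY NAME, not re-proved); no Literature fact is minted, every input is a kernel theorem.
Value = kernel certificate of a located by-reference step of B3 for the zero-background box instance, NOT summit progress.
Unit `lit-balaban-p03-g4` (Phase-2 proof seat p03, gen 4); HOME `run/shared/lean/pub/lit-balaban/` (row B3.Eq2.10, FILED.md, STATUS.md).
-/

namespace Literature.MathematicalPhysics.QuantumFieldTheory.Balaban1983to89.B3Ineq210ZeroBox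

open Finset Matrix
open Literature.MathematicalPhysics.QuantumFieldTheory.Balaban1983to89.B4ContourShift
open Literature.MathematicalPhysics.QuantumFieldTheory.Balaban1983to89.B4Reflection242
open Literature.MathematicalPhysics.QuantumFieldTheory.Balaban1983to89.B4BoxCov237
open Literature.MathematicalPhysics.QuantumFieldTheory.Balaban1983to89.B4Thm110ZeroBox
open Literature.MathematicalPhysics.QuantumFieldTheory.Balaban1983to89.B4Thm110ZeroBoxDeriv
open Literature.MathematicalPhysics.QuantumFieldTheory.Balaban1983to89.B3Sect2StatementsPart2
open B4Sect5Proof (latticeConst latticeConst_nonneg)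

noncomputable section

variable {d : ℕ}

/-! ## §1 Exponential bookkeeping and the pointwise triple-product estimate -/

/-- kernel: three decaying factors along a chain `β → y → y′ → β′` dominate one decaying factor in `D ≤ p + q + r`
at the rate `min(κ,δ)/2`, keeping half of the first two rates for the two summations. [folklore] -/
private theorem exp_chain3 {κ δ p q r D : ℝ} (hκ : 0 ≤ κ) (hδ : 0 ≤ δ) (hp : 0 ≤ p) (hq : 0 ≤ q) (hr : 0 ≤ r)
    (hD : D ≤ p + q + r) :
    Real.exp (-(κ * p)) * Real.exp (-(δ * q)) * Real.exp (-(κ * r))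
      ≤ Real.exp (-(min κ δ / 2 * D)) * (Real.exp (-(κ / 2 * p)) * Real.exp (-(δ / 2 * q))) := by
  simp only [← Real.exp_add]
  apply Real.exp_le_exp.2
  have h1 : min κ δ ≤ κ := min_le_left _ _
  have h2 : min κ δ ≤ δ := min_le_right _ _
  have h0 : 0 ≤ min κ δ := le_min hκ hδ
  have e1 : min κ δ / 2 * D ≤ min κ δ / 2 * (p + q + r) := mul_le_mul_of_nonneg_left hD (by linarith)
  have e2 : min κ δ / 2 * p ≤ κ / 2 * p := mul_le_mul_of_nonneg_right (by linarith) hp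
  have e3 : min κ δ / 2 * q ≤ δ / 2 * q := mul_le_mul_of_nonneg_right (by linarith) hq
  have e4 : min κ δ / 2 * r ≤ κ * r := mul_le_mul_of_nonneg_right (by linarith) hr
  linarith

/-- kernel: `|β − β′|_∞ ≤ |β − y|_∞ + |y − y′|_∞ + |β′ − y′|_∞`. [folklore] -/
private theorem supNorm_chain (β y y' β' : Fin (d + 1) → ℤ) :
    supNorm (β - β') ≤ supNorm (β - y) + supNorm (y - y') + supNorm (β' - y') := by
  have t1 := supNorm_sub_le_sub_add_sub β y β'
  have t2 := supNorm_sub_le_sub_add_sub y y' β'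
  rw [show supNorm (y' - β') = supNorm (β' - y') from by rw [← B4TorusKernel.supNorm_neg, neg_sub]] at t2
  linarith

section Pointwise

variable {N : Fin (d + 1) → ℕ}

/-- kernel: one term of the triple product. [folklore] -/
private theorem term3_le (β β' y y' : ↥(boxDom N)) {gy Cyy hy cA cC cB κ δ : ℝ} (hcA : 0 ≤ cA) (hcC : 0 ≤ cC)
    (hcB : 0 ≤ cB) (hκ : 0 < κ) (hδ : 0 < δ)
    (hg : |gy| ≤ cA * Real.exp (-(κ * supNorm (β.1 - y.1))))
    (hC : |Cyy| ≤ cC * Real.exp (-(δ * supNorm (y.1 - y'.1))))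
    (hh : |hy| ≤ cB * Real.exp (-(κ * supNorm (β'.1 - y'.1)))) :
    |gy * Cyy * hy| ≤ cA * cC * cB * Real.exp (-(min κ δ / 2 * supNorm (β.1 - β'.1)))
      * (Real.exp (-(κ / 2 * supNorm (β.1 - y.1))) * Real.exp (-(δ / 2 * supNorm (y.1 - y'.1)))) := by
  have n1 : 0 ≤ cA * Real.exp (-(κ * supNorm (β.1 - y.1))) := mul_nonneg hcA (Real.exp_pos _).le
  have n2 : 0 ≤ cC * Real.exp (-(δ * supNorm (y.1 - y'.1))) := mul_nonneg hcC (Real.exp_pos _).le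
  have hprod := mul_le_mul (mul_le_mul hg hC (abs_nonneg _) n1) hh (abs_nonneg _) (mul_nonneg n1 n2)
  have hch := exp_chain3 hκ.le hδ.le (supNorm_nonneg (β.1 - y.1)) (supNorm_nonneg (y.1 - y'.1))
    (supNorm_nonneg (β'.1 - y'.1)) (supNorm_chain β.1 y.1 y'.1 β'.1)
  have hc0 : 0 ≤ cA * cC * cB := mul_nonneg (mul_nonneg hcA hcC) hcB
  calc |gy * Cyy * hy| = |gy| * |Cyy| * |hy| := by rw [abs_mul, abs_mul]
    _ ≤ cA * Real.exp (-(κ * supNorm (β.1 - y.1))) * (cC * Real.exp (-(δ * supNorm (y.1 - y'.1))))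
        * (cB * Real.exp (-(κ * supNorm (β'.1 - y'.1)))) := hprod
    _ = cA * cC * cB * (Real.exp (-(κ * supNorm (β.1 - y.1))) * Real.exp (-(δ * supNorm (y.1 - y'.1)))
        * Real.exp (-(κ * supNorm (β'.1 - y'.1)))) := by ring
    _ ≤ cA * cC * cB * (Real.exp (-(min κ δ / 2 * supNorm (β.1 - β'.1)))
        * (Real.exp (-(κ / 2 * supNorm (β.1 - y.1))) * Real.exp (-(δ / 2 * supNorm (y.1 - y'.1))))) :=
        mul_le_mul_of_nonneg_left hch hc0
    _ = _ := by ring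

/-- kernel: the double geometric sum `Σ_y e^{−(κ/2)|β−y|} Σ_{y′} e^{−(δ/2)|y−y′|} ≤ K(κ/2)K(δ/2)`. [folklore] -/
private theorem sum2_exp_le (β : ↥(boxDom N)) {κ δ : ℝ} (hκ : 0 < κ) (hδ : 0 < δ) :
    ∑ y' : ↥(boxDom N), ∑ y : ↥(boxDom N),
        Real.exp (-(κ / 2 * supNorm (β.1 - y.1))) * Real.exp (-(δ / 2 * supNorm (y.1 - y'.1)))
      ≤ latticeConst (d + 1) (κ / 2) * latticeConst (d + 1) (δ / 2) := by
  have hKδ : 0 ≤ latticeConst (d + 1) (δ / 2) := latticeConst_nonneg _ (half_pos hδ).le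
  have hrowδ : ∀ y : ↥(boxDom N), ∑ y' : ↥(boxDom N), Real.exp (-(δ / 2 * supNorm (y.1 - y'.1)))
      ≤ latticeConst (d + 1) (δ / 2) := fun y => rho_sumBound N (δ / 2) (half_pos hδ) y
  have hrowκ : ∑ y : ↥(boxDom N), Real.exp (-(κ / 2 * supNorm (β.1 - y.1))) ≤ latticeConst (d + 1) (κ / 2) :=
    rho_sumBound N (κ / 2) (half_pos hκ) β
  rw [Finset.sum_comm]
  calc ∑ y : ↥(boxDom N), ∑ y' : ↥(boxDom N),
          Real.exp (-(κ / 2 * supNorm (β.1 - y.1))) * Real.exp (-(δ / 2 * supNorm (y.1 - y'.1)))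
      = ∑ y : ↥(boxDom N), Real.exp (-(κ / 2 * supNorm (β.1 - y.1)))
          * ∑ y' : ↥(boxDom N), Real.exp (-(δ / 2 * supNorm (y.1 - y'.1))) := by
        refine Finset.sum_congr rfl fun y _ => ?_
        rw [Finset.mul_sum]
    _ ≤ ∑ y : ↥(boxDom N), Real.exp (-(κ / 2 * supNorm (β.1 - y.1))) * latticeConst (d + 1) (δ / 2) :=
        Finset.sum_le_sum fun y _ => mul_le_mul_of_nonneg_left (hrowδ y) (Real.exp_pos _).le
    _ = (∑ y : ↥(boxDom N), Real.exp (-(κ / 2 * supNorm (β.1 - y.1)))) * latticeConst (d + 1) (δ / 2) := by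
        rw [Finset.sum_mul]
    _ ≤ latticeConst (d + 1) (κ / 2) * latticeConst (d + 1) (δ / 2) :=
        mul_le_mul_of_nonneg_right hrowκ hKδ

/-- kernel: **THE POINTWISE TRIPLE-PRODUCT ESTIMATE** — for a vector `g` decaying about `β`, a kernel `C` decaying
off the diagonal and a vector `h` decaying about `β′` (all on one unit box, sup-distance, rates `κ, δ, κ`),
`|Σ_{y′}Σ_y g(y)C(y,y′)h(y′)| ≤ c_Ac_Cc_B·K(κ/2)K(δ/2)·e^{−(min(κ,δ)/2)|β−β′|}` — the pointwise twin of the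
row-sum bookkeeping of [B4] (2.38)–(2.39) (`B4Thm110ZeroBox.step_term_bound`). [folklore] -/
private theorem abs_sum2_le (β β' : ↥(boxDom N)) (g h : ↥(boxDom N) → ℝ)
    (C : Matrix ↥(boxDom N) ↥(boxDom N) ℝ) {cA cC cB κ δ : ℝ} (hcA : 0 ≤ cA) (hcC : 0 ≤ cC) (hcB : 0 ≤ cB)
    (hκ : 0 < κ) (hδ : 0 < δ)
    (hg : ∀ y, |g y| ≤ cA * Real.exp (-(κ * supNorm (β.1 - y.1))))
    (hC : ∀ y y', |C y y'| ≤ cC * Real.exp (-(δ * supNorm (y.1 - y'.1))))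
    (hh : ∀ y', |h y'| ≤ cB * Real.exp (-(κ * supNorm (β'.1 - y'.1)))) :
    |∑ y' : ↥(boxDom N), ∑ y : ↥(boxDom N), g y * C y y' * h y'|
      ≤ cA * cC * cB * (latticeConst (d + 1) (κ / 2) * latticeConst (d + 1) (δ / 2))
        * Real.exp (-(min κ δ / 2 * supNorm (β.1 - β'.1))) := by
  have hc1 : 0 ≤ cA * cC * cB * Real.exp (-(min κ δ / 2 * supNorm (β.1 - β'.1))) :=
    mul_nonneg (mul_nonneg (mul_nonneg hcA hcC) hcB) (Real.exp_pos _).le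
  have s1 : |∑ y' : ↥(boxDom N), ∑ y : ↥(boxDom N), g y * C y y' * h y'|
      ≤ ∑ y' : ↥(boxDom N), ∑ y : ↥(boxDom N), |g y * C y y' * h y'| :=
    (Finset.abs_sum_le_sum_abs _ _).trans (Finset.sum_le_sum fun y' _ => Finset.abs_sum_le_sum_abs _ _)
  have s2 : ∑ y' : ↥(boxDom N), ∑ y : ↥(boxDom N), |g y * C y y' * h y'|
      ≤ ∑ y' : ↥(boxDom N), ∑ y : ↥(boxDom N), cA * cC * cB * Real.exp (-(min κ δ / 2 * supNorm (β.1 - β'.1)))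
          * (Real.exp (-(κ / 2 * supNorm (β.1 - y.1))) * Real.exp (-(δ / 2 * supNorm (y.1 - y'.1)))) :=
    Finset.sum_le_sum fun y' _ => Finset.sum_le_sum fun y _ =>
      term3_le β β' y y' hcA hcC hcB hκ hδ (hg y) (hC y y') (hh y')
  have s3 : ∑ y' : ↥(boxDom N), ∑ y : ↥(boxDom N), cA * cC * cB * Real.exp (-(min κ δ / 2 * supNorm (β.1 - β'.1)))
          * (Real.exp (-(κ / 2 * supNorm (β.1 - y.1))) * Real.exp (-(δ / 2 * supNorm (y.1 - y'.1))))
      = cA * cC * cB * Real.exp (-(min κ δ / 2 * supNorm (β.1 - β'.1)))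
          * ∑ y' : ↥(boxDom N), ∑ y : ↥(boxDom N), (Real.exp (-(κ / 2 * supNorm (β.1 - y.1)))
              * Real.exp (-(δ / 2 * supNorm (y.1 - y'.1)))) := by
    rw [Finset.mul_sum]
    refine Finset.sum_congr rfl fun y' _ => ?_
    rw [Finset.mul_sum]
  have s4 := mul_le_mul_of_nonneg_left (sum2_exp_le β hκ hδ) hc1
  calc |∑ y' : ↥(boxDom N), ∑ y : ↥(boxDom N), g y * C y y' * h y'|
      ≤ cA * cC * cB * Real.exp (-(min κ δ / 2 * supNorm (β.1 - β'.1)))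
          * (latticeConst (d + 1) (κ / 2) * latticeConst (d + 1) (δ / 2)) := by linarith
    _ = _ := by ring

end Pointwise

/-! ## §2 The scale pieces `G^η_{(j)}` of (2.6) at `A = B̃ = 0` on a box, and the identity (2.6) itself -/

section Pieces

variable {ℓ k j : ℕ} {M : Fin (d + 1) → ℕ} {a m2 : ℝ}

/-- **The scale pieces of (2.6)** for the model instance `A = B̃ = 0`, `Ω = □ = Π_μ[0, M_μ)` (lattice `ηℤ^{d+1} ∩ □`,
`η = L^{-k}`, `L = ℓ + 1`, in the counting-measure («values») normalisation of `B4Thm110ZeroBox`):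
`G^η_{(0)} = C^{(0),η}(□) = 𝒢_1`, `G^η_{(j)} = a_j²(L^jη)^{−4}G^η_jQ_j^*C^{(j)}Q_jG^η_j = 𝒢_{j+1} − 𝒢_j` for `1 ≤ j ≤ k − 1`
(`B4Thm110ZeroBox.Gfine_succ_sub`: `= α_j²·A_jC_jB_j`), and `0` for `j ≥ k` (the decomposition (2.6) has `k` pieces).
[cite: Balaban1983Higgs3, (2.6) p.424] -/
def piece (ℓ k : ℕ) (M : Fin (d + 1) → ℕ) (j : ℕ) (a m2 : ℝ) :
    Matrix ↥(boxDom (Nf ℓ k M)) ↥(boxDom (Nf ℓ k M)) ℝ :=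
  if j = 0 then Gfine ℓ k M 1 a m2
  else if j + 1 ≤ k then Gfine ℓ k M (j + 1) a m2 - Gfine ℓ k M j a m2 else 0

/-- `G^η_{(0)} = C^{(0),η}(□) = 𝒢_1`. [cite: Balaban1983Higgs3, (2.6) p.424] -/
theorem piece_zero : piece ℓ k M 0 a m2 = Gfine ℓ k M 1 a m2 := by
  simp [piece]

/-- `G^η_{(j)} = 𝒢_{j+1} − 𝒢_j` for `1 ≤ j ≤ k − 1`. [cite: Balaban1983Higgs3, (2.6) p.424] -/
theorem piece_of_pos (hj1 : 1 ≤ j) (hj : j + 1 ≤ k) :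
    piece ℓ k M j a m2 = Gfine ℓ k M (j + 1) a m2 - Gfine ℓ k M j a m2 := by
  unfold piece
  rw [if_neg (by omega), if_pos hj]

/-- no pieces beyond `j = k − 1`. [cite: Balaban1983Higgs3, (2.6) p.424] -/
theorem piece_of_le (hj1 : 1 ≤ j) (hkj : k ≤ j) : piece ℓ k M j a m2 = 0 := by
  unfold piece
  rw [if_neg (by omega), if_neg (by omega)]

/-- `G^η_{(j)} = α_j²·A_jC_jB_j` (`A_j = 𝒢_jQ_j^*`, `B_j = Q_j𝒢_j`, `C_j = (L^jη)²C^{(j)}(□)`) for `1 ≤ j ≤ k − 1` on the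
window. [cite: Balaban1983Higgs3, (2.6) p.424] -/
theorem piece_eq_ACB (hℓ : 1 ≤ ℓ) (hj1 : 1 ≤ j) (hj : j + 1 ≤ k) (hM : ∀ i, 1 ≤ M i) (ha : 0 < a)
    (hm : 0 ≤ m2) :
    piece ℓ k M j a m2 = αj a ℓ k j ^ 2 • (Amat ℓ k M j a m2 * Cmat ℓ k M j a m2 * Bmat ℓ k M j a m2) := by
  rw [piece_of_pos hj1 hj, Gfine_succ_sub hℓ hj1 hj hM ha hm]

/-- **(2.6) for the model instance**: `Σ_{j=0}^{k−1} G^η_{(j)} = G_k(□) = 𝒢_k` (telescoping of B4 (2.34)).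
[cite: Balaban1983Higgs3, (2.6) p.424] -/
theorem sum_piece (hk : 1 ≤ k) : ∑ j ∈ Finset.range k, piece ℓ k M j a m2 = Gfine ℓ k M k a m2 := by
  have main : ∀ n, 1 ≤ n → n ≤ k → ∑ j ∈ Finset.range n, piece ℓ k M j a m2 = Gfine ℓ k M n a m2 := by
    intro n hn
    induction n, hn using Nat.le_induction with
    | base =>
      intro _
      rw [Finset.sum_range_one, piece_zero]
    | succ n hn ih =>
      intro hnk
      rw [Finset.sum_range_succ, ih (by omega), piece_of_pos hn hnk, add_sub_cancel]
  exact main k hk le_rfl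

/-- (2.6) with the right side written as the propagator itself: `Σ_{j<k} G^η_{(j)} = G_k(□) =
(−Δ^{η,N}_□ + m² + a_kP_k)^{-1}` (values form `B4BoxCov237.boxOpR (L^k) a_k m² M`). [cite: Balaban1983Higgs3, (2.6) p.424] -/
theorem sum_piece_eq_inv (hk : 1 ≤ k) :
    ∑ j ∈ Finset.range k, piece ℓ k M j a m2
      = (boxOpR ((ℓ + 1) ^ k) (B1.aSeq a ((ℓ : ℝ) + 1) k) m2 M)⁻¹ := by
  rw [sum_piece hk]
  unfold Gfine
  rw [fineOp_top]

end Pieces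

/-! ## §3 The value clause of (2.10) in the counting normalisation:
`|G^η_{(j)}(x,x′)| ≤ C·L^{−j(d+1)}·(L^jη)²·e^{−δ₁|x−x′|_∞/L^j}` -/

/-- kernel: the `j = 0` piece — the one-step box Green's function `𝒢_1 = (Lη)²·B^{-1}` decays on the lattice scale
(`B4Thm110ZeroBox.boxOpR_L_inv_decay`), with the factor `s_1^{-2} = (Lη)²` kept. [folklore] -/
private theorem abs_Gfine_one_le (d ℓ : ℕ) (hℓ : 1 ≤ ℓ) (amin aplus m2plus : ℝ) (ha : 0 < amin) :
    ∃ r C₀ : ℝ, 0 < r ∧ 0 < C₀ ∧ ∀ (k : ℕ), 1 ≤ k → ∀ (a m2 : ℝ), amin ≤ a → a ≤ aplus → 0 ≤ m2 →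
      m2 ≤ m2plus → ∀ (M : Fin (d + 1) → ℕ), (∀ i, 1 ≤ M i) → ∀ (x x' : ↥(boxDom (Nf ℓ k M))),
        |Gfine ℓ k M 1 a m2 x x'| ≤ (sc ℓ k 1 ^ 2)⁻¹ * C₀ * Real.exp (-(r * supNorm (x.1 - x'.1))) := by
  obtain ⟨r, C₀, hr, hC₀, hdec⟩ := boxOpR_L_inv_decay d ℓ hℓ (amin * (1 - ((((ℓ : ℝ) + 1)) ^ 2)⁻¹))
    aplus m2plus (aminus'_pos hℓ ha)
  refine ⟨r, C₀, hr, hC₀, fun k hk a m2 h1 h2 h3 h4 M hM x x' => ?_⟩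
  have ha0 : 0 < a := lt_of_lt_of_le ha h1
  obtain ⟨hw1, hw2, -⟩ := aSeq_window hℓ ha h1 h2 (le_refl 1)
  rcases Nat.lt_or_ge k 2 with hk2 | hk2
  · obtain rfl : k = 1 := by omega
    have hG : Gfine ℓ 1 M 1 a m2 = (boxOpR ((ℓ + 1) ^ 1) (B1.aSeq a ((ℓ : ℝ) + 1) 1) m2 M)⁻¹ := by
      unfold Gfine
      rw [fineOp_top]
    rw [hG, sc_self, one_pow, inv_one, one_mul]
    exact hdec ((ℓ + 1) ^ 1) (pow_one _) _ _ hw1 hw2 h3 h4 M x x'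
  · have hs : 0 < sc ℓ k 1 ^ 2 := pow_pos (sc_pos ℓ k 1) 2
    have hm' : 0 ≤ m2 / sc ℓ k 1 ^ 2 := div_nonneg h3 hs.le
    have hm'' : m2 / sc ℓ k 1 ^ 2 ≤ m2plus := (div_le_self h3 (one_le_pow₀ (one_le_sc ℓ k 1))).trans h4
    rw [Gfine_apply hℓ (le_refl 1) hk2 hM ha0 h3 x x', abs_mul, abs_of_pos (inv_pos.2 hs), mul_assoc]
    exact mul_le_mul_of_nonneg_left
      (hdec (bj ℓ 1) (pow_one _) _ _ hw1 hw2 hm' hm'' (Mj ℓ k M 1) ((ej ℓ k M 1 hk2).symm x)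
        ((ej ℓ k M 1 hk2).symm x')) (inv_pos.2 hs).le


/-- kernel: from `|x − x′|_∞ ≤ b(|β_x − β_{x′}|_∞ + 1)` (points of two `b`-blocks): the block-label decay
`e^{−ρ|β_x−β_{x′}|}` is a fine-lattice decay `e^{ρ}·e^{−δ₁|x−x′|/b}` for every `δ₁ ≤ ρ`. [folklore] -/
private theorem exp_blk_le {ρ δ₁ n D b : ℝ} (hρ : 0 ≤ ρ) (hδρ : δ₁ ≤ ρ) (hb : 0 < b) (hn : 0 ≤ n)
    (hnD : n ≤ b * (D + 1)) :
    Real.exp (-(ρ * D)) ≤ Real.exp ρ * Real.exp (-(δ₁ * n / b)) := by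
  rw [← Real.exp_add]
  apply Real.exp_le_exp.2
  have h1 : n / b ≤ D + 1 := by rw [div_le_iff₀ hb]; linarith
  have h2 : δ₁ * n / b = δ₁ * (n / b) := by ring
  have h3 : δ₁ * (n / b) ≤ ρ * (n / b) := mul_le_mul_of_nonneg_right hδρ (div_nonneg hn hb.le)
  have h4 : ρ * (n / b) ≤ ρ * (D + 1) := mul_le_mul_of_nonneg_left h1 hρ
  rw [h2]
  linarith

/-- kernel: `b_0 = L^0 = 1`. [folklore] -/
private theorem bj_zero_cast (ℓ : ℕ) : ((bj ℓ 0 : ℕ) : ℝ) = 1 := by simp [bj]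

section Value

variable {ℓ k j : ℕ} {M : Fin (d + 1) → ℕ} {a m2 : ℝ}

/-- kernel: the triple product `(A_jC_jB_j)(x,x′)` as a double sum. [folklore] -/
private theorem ACB_apply (x x' : ↥(boxDom (Nf ℓ k M))) :
    (Amat ℓ k M j a m2 * Cmat ℓ k M j a m2 * Bmat ℓ k M j a m2) x x'
      = ∑ y' : ↥(boxDom (Mj ℓ k M j)), ∑ y : ↥(boxDom (Mj ℓ k M j)),
          Amat ℓ k M j a m2 x y * Cmat ℓ k M j a m2 y y' * Bmat ℓ k M j a m2 y' x' := by
  simp only [Matrix.mul_apply, Finset.sum_mul]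

end Value

/-- **B3 (2.10) p. 426 [PDF 16], VALUE CLAUSE, for the model instance `A = B̃ = 0`, `Ω = □`** (counting
normalisation of `B4Thm110ZeroBox`; the `η^d`-normalised form is `ineq210_zeroBox` below): there are `δ₁ > 0`,
`C > 0` depending only on `d`, `L = ℓ + 1` and the window `[a₋,a₊] × [0,m²₊]` such that for every `k ≥ 1`, every
`j < k`, every point of the window, every box `□ = Π_μ[0,M_μ)` (`M_μ ≥ 1`) and all fine sites `x, x′`:
`|G^η_{(j)}(x,x′)| ≤ C·L^{−j(d+1)}·(L^jη)²·e^{−δ₁|x−x′|_∞/L^j}` — i.e. the printed `O(1)(L^jη)^{−d+2}e^{−δ₁(L^jη)^{−1}|x−x′|}`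
after multiplication by the volume factor `η^{d+1}` of the counting normalisation (`|x−x′|` of the print `= η|x−x′|_∞`
here, sup norm in lattice units).  Inputs, all kernel-proved in the B4 lineage at `A = 0` on boxes: the block-row
form of B4 (2.35) (`B4Thm110ZeroBox.Gfine_blockRow_bound`), B4 (2.37) (`B4BoxCov237.cov237_box_decay`), the one-step
base (`B4Thm110ZeroBox.boxOpR_L_inv_decay`) — B3 p. 426: *"They all are obtained by rescaling from the η-lattice to
the L^{−j}-lattice and application of Propositions I.2.1 and I.2.3"*; B4 p. 583, Remark: *"the above method can be
used also to prove pointwise estimates of G_k(□) … their derivatives"*. [cite: Balaban1983Higgs3, (2.10) p.426] -/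
theorem abs_piece_le (d ℓ : ℕ) (hℓ : 1 ≤ ℓ) (amin aplus m2plus : ℝ) (ha : 0 < amin) :
    ∃ δ₁ C : ℝ, 0 < δ₁ ∧ 0 < C ∧ ∀ (k : ℕ), 1 ≤ k → ∀ (j : ℕ), j < k → ∀ (a m2 : ℝ), amin ≤ a → a ≤ aplus →
      0 ≤ m2 → m2 ≤ m2plus → ∀ (M : Fin (d + 1) → ℕ), (∀ i, 1 ≤ M i) → ∀ (x x' : ↥(boxDom (Nf ℓ k M))),
        |piece ℓ k M j a m2 x x'|
          ≤ C * ((((bj ℓ j : ℕ) : ℝ) ^ (d + 1))⁻¹ * (sc ℓ k j ^ 2)⁻¹)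
            * Real.exp (-(δ₁ * supNorm (x.1 - x'.1) / ((bj ℓ j : ℕ) : ℝ))) := by
  obtain ⟨r, C₀, hr, hC₀, hone⟩ := abs_Gfine_one_le d ℓ hℓ amin aplus m2plus ha
  obtain ⟨κ, C₁, hκ, hC₁, hR⟩ := Gfine_blockRow_bound d ℓ hℓ amin aplus m2plus ha
  obtain ⟨δ, c₂, hδ, hc₂, hCov⟩ := cov237_box_decay d ℓ hℓ (amin * (1 - ((((ℓ : ℝ) + 1)) ^ 2)⁻¹)) aplus
    m2plus amin aplus (aminus'_pos hℓ ha) ha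
  have hKκ : 0 ≤ latticeConst (d + 1) (κ / 2) := latticeConst_nonneg _ (half_pos hκ).le
  have hKδ : 0 ≤ latticeConst (d + 1) (δ / 2) := latticeConst_nonneg _ (half_pos hδ).le
  have hρ0 : 0 < min κ δ / 2 := half_pos (lt_min hκ hδ)
  have hL : (0 : ℝ) < (ℓ : ℝ) + 1 := by positivity
  have hCmid : 0 ≤ aplus ^ 2 * (C₁ * c₂ * C₁)
      * (latticeConst (d + 1) (κ / 2) * latticeConst (d + 1) (δ / 2)) * Real.exp (min κ δ / 2) :=
    mul_nonneg (mul_nonneg (mul_nonneg (sq_nonneg _) (mul_nonneg (mul_nonneg hC₁ hc₂.le) hC₁))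
      (mul_nonneg hKκ hKδ)) (Real.exp_pos _).le
  have hCzero : 0 < C₀ * ((ℓ : ℝ) + 1) ^ 2 := by positivity
  refine ⟨min (min κ δ / 2) r, C₀ * ((ℓ : ℝ) + 1) ^ 2 + aplus ^ 2 * (C₁ * c₂ * C₁)
      * (latticeConst (d + 1) (κ / 2) * latticeConst (d + 1) (δ / 2)) * Real.exp (min κ δ / 2),
    lt_min hρ0 hr, by linarith, ?_⟩
  intro k hk j hjk a m2 h1 h2 h3 h4 M hM x x'
  have ha0 : 0 < a := lt_of_lt_of_le ha h1
  have hn0 : 0 ≤ supNorm (x.1 - x'.1) := supNorm_nonneg _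
  have hmin0 : 0 ≤ min (min κ δ / 2) r := (lt_min hρ0 hr).le
  rcases Nat.eq_zero_or_pos j with rfl | hj1
  · -- the piece `j = 0`: `𝒢_1`, lattice-scale decay
    rw [piece_zero, bj_zero_cast, one_pow, inv_one, one_mul, div_one]
    have h := hone k hk a m2 h1 h2 h3 h4 M hM x x'
    have hs1 : 0 < sc ℓ k 1 ^ 2 := pow_pos (sc_pos ℓ k 1) 2
    have hs0 : sc ℓ k 0 = ((ℓ : ℝ) + 1) * sc ℓ k 1 := sc_eq_succ (by omega : 0 + 1 ≤ k)
    have heq : (sc ℓ k 1 ^ 2)⁻¹ * C₀ = C₀ * ((ℓ : ℝ) + 1) ^ 2 * (sc ℓ k 0 ^ 2)⁻¹ := by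
      rw [hs0]
      field_simp
    have hexp : Real.exp (-(r * supNorm (x.1 - x'.1)))
        ≤ Real.exp (-(min (min κ δ / 2) r * supNorm (x.1 - x'.1))) :=
      Real.exp_le_exp.2 (by nlinarith [min_le_right (min κ δ / 2) r])
    have hs0i : 0 ≤ (sc ℓ k 0 ^ 2)⁻¹ := (inv_pos.2 (pow_pos (sc_pos ℓ k 0) 2)).le
    calc |Gfine ℓ k M 1 a m2 x x'|
        ≤ (sc ℓ k 1 ^ 2)⁻¹ * C₀ * Real.exp (-(r * supNorm (x.1 - x'.1))) := h
      _ ≤ (sc ℓ k 1 ^ 2)⁻¹ * C₀ * Real.exp (-(min (min κ δ / 2) r * supNorm (x.1 - x'.1))) :=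
          mul_le_mul_of_nonneg_left hexp (mul_nonneg (inv_pos.2 hs1).le hC₀.le)
      _ = C₀ * ((ℓ : ℝ) + 1) ^ 2 * (sc ℓ k 0 ^ 2)⁻¹
          * Real.exp (-(min (min κ δ / 2) r * supNorm (x.1 - x'.1))) := by rw [heq]
      _ ≤ _ := by
          refine mul_le_mul_of_nonneg_right (mul_le_mul_of_nonneg_right (by linarith) hs0i) (Real.exp_pos _).le
  · -- the pieces `1 ≤ j ≤ k − 1`: `α_j²·A_jC_jB_j`
    have hj : j + 1 ≤ k := by omega
    obtain ⟨hw1, hw2, hapos⟩ := aSeq_window hℓ ha h1 h2 hj1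
    have hs : 0 < sc ℓ k j ^ 2 := pow_pos (sc_pos ℓ k j) 2
    have hsi : 0 < (sc ℓ k j ^ 2)⁻¹ := inv_pos.2 hs
    have hsc0 : sc ℓ k j ≠ 0 := (sc_pos ℓ k j).ne'
    have hm' : 0 ≤ m2 / sc ℓ k j ^ 2 := div_nonneg h3 hs.le
    have hm'' : m2 / sc ℓ k j ^ 2 ≤ m2plus := (div_le_self h3 (one_le_pow₀ (one_le_sc ℓ k j))).trans h4
    have hb1 : 1 ≤ bj ℓ j := bj_pos ℓ j
    have hbR : (0 : ℝ) < ((bj ℓ j : ℕ) : ℝ) := by positivity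
    have hbD : (0 : ℝ) < ((bj ℓ j : ℕ) : ℝ) ^ (d + 1) := by positivity
    -- entry bounds of the three kernels (as in `B4Thm110ZeroBox.step_term_bound`)
    have hA : ∀ (y : ↥(boxDom (Mj ℓ k M j))),
        |Amat ℓ k M j a m2 x y|
          ≤ (sc ℓ k j ^ 2)⁻¹ * C₁ * Real.exp (-(κ * supNorm (blk (bj ℓ j) x.1 - y.1))) := by
      intro y
      have hAxy : Amat ℓ k M j a m2 x y
          = ∑ x', (if blk (bj ℓ j) x'.1 = y.1 then Gfine ℓ k M j a m2 x x' else 0) := by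
        simp only [Amat, Matrix.mul_apply, QksM, Matrix.of_apply, mul_ite, mul_one, mul_zero]
      rw [hAxy]
      exact hR k j hj1 hj a m2 h1 h2 h3 h4 M hM x y.1 y.2
    have hB : ∀ (y' : ↥(boxDom (Mj ℓ k M j))),
        |Bmat ℓ k M j a m2 y' x'| ≤ ((((bj ℓ j : ℕ) : ℝ)) ^ (d + 1))⁻¹ * ((sc ℓ k j ^ 2)⁻¹ * C₁)
          * Real.exp (-(κ * supNorm (blk (bj ℓ j) x'.1 - y'.1))) := by
      intro y'
      have hBe : Bmat ℓ k M j a m2 y' x' = ((((bj ℓ j : ℕ) : ℝ)) ^ (d + 1))⁻¹ *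
          ∑ w, (if blk (bj ℓ j) w.1 = y'.1 then Gfine ℓ k M j a m2 x' w else 0) := by
        simp only [Bmat, Matrix.mul_apply, QkM, Matrix.of_apply, Finset.mul_sum]
        refine Finset.sum_congr rfl fun w _ => ?_
        split_ifs with hw
        · rw [(Gfine_isSymm ℓ k M j a m2).apply x' w]
        · rw [zero_mul, mul_zero]
      rw [hBe, abs_mul, abs_of_pos (inv_pos.2 hbD), mul_assoc]
      exact mul_le_mul_of_nonneg_left (hR k j hj1 hj a m2 h1 h2 h3 h4 M hM x' y'.1 y'.2) (inv_pos.2 hbD).le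
    have hC : ∀ (y y' : ↥(boxDom (Mj ℓ k M j))),
        |Cmat ℓ k M j a m2 y y'| ≤ (sc ℓ k j ^ 2)⁻¹ * c₂ * Real.exp (-(δ * supNorm (y.1 - y'.1))) := by
      intro y y'
      have h := (hCov (bj ℓ j) hb1 _ _ a hw1 hw2 hm' hm'' h1 h2 (Mp ℓ k M j) (Mp_pos hM)).2 y y'
      rw [Cmat, Matrix.smul_apply, smul_eq_mul, abs_mul, abs_of_pos hsi, mul_assoc]
      exact mul_le_mul_of_nonneg_left h hsi.le
    -- the pointwise triple-product estimate
    have key := abs_sum2_le (N := Mj ℓ k M j) ⟨blk (bj ℓ j) x.1, blk_bj_mem hj M x⟩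
      ⟨blk (bj ℓ j) x'.1, blk_bj_mem hj M x'⟩ (fun y => Amat ℓ k M j a m2 x y) (fun y' => Bmat ℓ k M j a m2 y' x')
      (Cmat ℓ k M j a m2) (mul_nonneg hsi.le hC₁) (mul_nonneg hsi.le hc₂.le)
      (mul_nonneg (inv_pos.2 hbD).le (mul_nonneg hsi.le hC₁)) hκ hδ hA hC hB
    rw [← ACB_apply] at key
    -- `α_j² ≤ a₊²·s_j⁴`
    have hα : αj a ℓ k j ^ 2 ≤ aplus ^ 2 * (sc ℓ k j ^ 2) ^ 2 := by
      unfold αj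
      rw [mul_pow]
      exact mul_le_mul_of_nonneg_right (pow_le_pow_left₀ hapos.le hw2 2) (by positivity)
    -- the block-label decay as a fine-lattice decay at rate `δ₁/L^j`
    have hE := exp_blk_le (δ₁ := min (min κ δ / 2) r) hρ0.le (min_le_left _ _) hbR hn0
      (supNorm_sub_le_blk hb1 x.1 x'.1)
    rw [piece_eq_ACB hℓ hj1 hj hM ha0 h3, Matrix.smul_apply, smul_eq_mul, abs_mul, abs_of_nonneg (sq_nonneg _)]
    have hP0 : 0 ≤ (sc ℓ k j ^ 2)⁻¹ * C₁ * ((sc ℓ k j ^ 2)⁻¹ * c₂)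
        * (((((bj ℓ j : ℕ) : ℝ)) ^ (d + 1))⁻¹ * ((sc ℓ k j ^ 2)⁻¹ * C₁))
        * (latticeConst (d + 1) (κ / 2) * latticeConst (d + 1) (δ / 2)) :=
      mul_nonneg (mul_nonneg (mul_nonneg (mul_nonneg hsi.le hC₁) (mul_nonneg hsi.le hc₂.le))
        (mul_nonneg (inv_pos.2 hbD).le (mul_nonneg hsi.le hC₁))) (mul_nonneg hKκ hKδ)
    calc αj a ℓ k j ^ 2 * |(Amat ℓ k M j a m2 * Cmat ℓ k M j a m2 * Bmat ℓ k M j a m2) x x'|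
        ≤ (aplus ^ 2 * (sc ℓ k j ^ 2) ^ 2) *
            ((sc ℓ k j ^ 2)⁻¹ * C₁ * ((sc ℓ k j ^ 2)⁻¹ * c₂)
              * (((((bj ℓ j : ℕ) : ℝ)) ^ (d + 1))⁻¹ * ((sc ℓ k j ^ 2)⁻¹ * C₁))
              * (latticeConst (d + 1) (κ / 2) * latticeConst (d + 1) (δ / 2))
              * (Real.exp (min κ δ / 2)
                  * Real.exp (-(min (min κ δ / 2) r * supNorm (x.1 - x'.1) / ((bj ℓ j : ℕ) : ℝ))))) :=
          mul_le_mul hα (key.trans (mul_le_mul_of_nonneg_left hE hP0)) (abs_nonneg _) (by positivity)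
      _ = aplus ^ 2 * (C₁ * c₂ * C₁) * (latticeConst (d + 1) (κ / 2) * latticeConst (d + 1) (δ / 2))
            * Real.exp (min κ δ / 2)
            * ((((bj ℓ j : ℕ) : ℝ) ^ (d + 1))⁻¹ * (sc ℓ k j ^ 2)⁻¹)
            * Real.exp (-(min (min κ δ / 2) r * supNorm (x.1 - x'.1) / ((bj ℓ j : ℕ) : ℝ))) := by
          field_simp
      _ ≤ _ := by
          refine mul_le_mul_of_nonneg_right (mul_le_mul_of_nonneg_right (by linarith) ?_) (Real.exp_pos _).le
          exact mul_nonneg (inv_pos.2 hbD).le hsi.le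

/-! ## §4 The derivative clause of (2.10) in the counting normalisation:
`η^{-1}|G^η_{(j)}(x+ηe_μ,x′) − G^η_{(j)}(x,x′)| ≤ C·L^{−j(d+1)}·(L^jη)·e^{−δ₁|x−x′|_∞/L^j}` — one factor `(L^jη)^{−1}` gained -/

/-- kernel: differencing an indicator-restricted row: `Σ(1_{c}a) − Σ(1_{c}b) = Σ 1_{c}(a − b)`. [folklore] -/
private theorem sum_ite_sub {ι : Type*} (s : Finset ι) (c : ι → Prop) [DecidablePred c] (f g : ι → ℝ) :
    ∑ i ∈ s, (if c i then f i else 0) - ∑ i ∈ s, (if c i then g i else 0)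
      = ∑ i ∈ s, (if c i then f i - g i else 0) := by
  rw [← Finset.sum_sub_distrib]
  refine Finset.sum_congr rfl fun i _ => ?_
  split_ifs <;> simp

/-- kernel: `L^k = s_0` (`s_j = L^{k−j}`). [folklore] -/
private theorem Lk_eq_sc_zero (ℓ k : ℕ) : ((((ℓ + 1) ^ k : ℕ)) : ℝ) = sc ℓ k 0 := by
  simp [sc]

/-- **B3 (2.10) p. 426 [PDF 16], DERIVATIVE CLAUSE («for each differentiation, there is an additional factor
(L^jη)^{−1} on the right side»), for the model instance `A = B̃ = 0`, `Ω = □`, once-differentiated kernel in the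
row variable** (counting normalisation; `D^η_{0,μ} = ∂^η_μ`, the forward difference along a bond `⟨x, x+ηe_μ⟩ ⊂ □`,
`η^{-1} = L^k`): there are `δ₁ > 0`, `C > 0` (depending on `d`, `L`, the window only) with
`L^k·|G^η_{(j)}(x+e_μ,x′) − G^η_{(j)}(x,x′)| ≤ C·L^{−j(d+1)}·(L^jη)·e^{−δ₁|x−x′|_∞/L^j}` for every `k ≥ 1`, `j < k`, every
point of the window, every box, every axis `μ` and all fine sites — the printed `O(1)(L^jη)^{−d+1}e^{−δ₁(L^jη)^{−1}|x−x′|}`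
times `η^{d+1}`.  Inputs: the block-row DERIVATIVE form of B4 (2.35) (`B4Thm110ZeroBoxDeriv.Gfine_blockRowDiff_bound`),
the value form (`B4Thm110ZeroBox.Gfine_blockRow_bound`), B4 (2.37) (`B4BoxCov237.cov237_box_decay`) and the one-step
base differenced crudely (at `j = 0` there is no factor to gain: `L^0η = η`). [cite: Balaban1983Higgs3, (2.10) p.426] -/
theorem abs_pieceDiff_le (d ℓ : ℕ) (hℓ : 1 ≤ ℓ) (amin aplus m2plus : ℝ) (ha : 0 < amin) :
    ∃ δ₁ C : ℝ, 0 < δ₁ ∧ 0 < C ∧ ∀ (k : ℕ), 1 ≤ k → ∀ (j : ℕ), j < k → ∀ (a m2 : ℝ), amin ≤ a → a ≤ aplus →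
      0 ≤ m2 → m2 ≤ m2plus → ∀ (M : Fin (d + 1) → ℕ), (∀ i, 1 ≤ M i) →
        ∀ (μ : Fin (d + 1)) (x xe : ↥(boxDom (Nf ℓ k M))), xe.1 = x.1 + Pi.single μ 1 →
        ∀ (x' : ↥(boxDom (Nf ℓ k M))),
          ((((ℓ + 1) ^ k : ℕ)) : ℝ) * |piece ℓ k M j a m2 xe x' - piece ℓ k M j a m2 x x'|
            ≤ C * ((((bj ℓ j : ℕ) : ℝ) ^ (d + 1))⁻¹ * (sc ℓ k j)⁻¹)
              * Real.exp (-(δ₁ * supNorm (x.1 - x'.1) / ((bj ℓ j : ℕ) : ℝ))) := by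
  obtain ⟨r, C₀, hr, hC₀, hone⟩ := abs_Gfine_one_le d ℓ hℓ amin aplus m2plus ha
  obtain ⟨κ, C₁, hκ, hC₁, hR⟩ := Gfine_blockRow_bound d ℓ hℓ amin aplus m2plus ha
  obtain ⟨κ', C', hκ', hC', hRD⟩ := Gfine_blockRowDiff_bound d ℓ hℓ amin aplus m2plus ha
  obtain ⟨δ, c₂, hδ, hc₂, hCov⟩ := cov237_box_decay d ℓ hℓ (amin * (1 - ((((ℓ : ℝ) + 1)) ^ 2)⁻¹)) aplus
    m2plus amin aplus (aminus'_pos hℓ ha) ha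
  have hκ₀ : 0 < min κ κ' := lt_min hκ hκ'
  have hKκ : 0 ≤ latticeConst (d + 1) (min κ κ' / 2) := latticeConst_nonneg _ (half_pos hκ₀).le
  have hKδ : 0 ≤ latticeConst (d + 1) (δ / 2) := latticeConst_nonneg _ (half_pos hδ).le
  have hρ0 : 0 < min (min κ κ') δ / 2 := half_pos (lt_min hκ₀ hδ)
  have hL : (0 : ℝ) < (ℓ : ℝ) + 1 := by positivity
  have hCmid : 0 ≤ aplus ^ 2 * (C' * c₂ * C₁)
      * (latticeConst (d + 1) (min κ κ' / 2) * latticeConst (d + 1) (δ / 2))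
      * Real.exp (min (min κ κ') δ / 2) :=
    mul_nonneg (mul_nonneg (mul_nonneg (sq_nonneg _) (mul_nonneg (mul_nonneg hC' hc₂.le) hC₁))
      (mul_nonneg hKκ hKδ)) (Real.exp_pos _).le
  have hCzero : 0 < C₀ * (Real.exp r + 1) * ((ℓ : ℝ) + 1) ^ 2 := by positivity
  refine ⟨min (min (min κ κ') δ / 2) r, C₀ * (Real.exp r + 1) * ((ℓ : ℝ) + 1) ^ 2
      + aplus ^ 2 * (C' * c₂ * C₁) * (latticeConst (d + 1) (min κ κ' / 2) * latticeConst (d + 1) (δ / 2))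
        * Real.exp (min (min κ κ') δ / 2), lt_min hρ0 hr, by linarith, ?_⟩
  intro k hk j hjk a m2 h1 h2 h3 h4 M hM μ x xe hxe x'
  have ha0 : 0 < a := lt_of_lt_of_le ha h1
  have hn0 : 0 ≤ supNorm (x.1 - x'.1) := supNorm_nonneg _
  have hLk : (0 : ℝ) < (((ℓ + 1) ^ k : ℕ) : ℝ) := by positivity
  rcases Nat.eq_zero_or_pos j with rfl | hj1
  · -- `j = 0`: crude differencing of the one-step Green's function
    rw [piece_zero, bj_zero_cast, one_pow, inv_one, one_mul, div_one]
    have g1 := hone k hk a m2 h1 h2 h3 h4 M hM xe x'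
    have g2 := hone k hk a m2 h1 h2 h3 h4 M hM x x'
    have hs1 : 0 < sc ℓ k 1 ^ 2 := pow_pos (sc_pos ℓ k 1) 2
    have hs1i : 0 ≤ (sc ℓ k 1 ^ 2)⁻¹ := (inv_pos.2 hs1).le
    have hs0 : sc ℓ k 0 = ((ℓ : ℝ) + 1) * sc ℓ k 1 := sc_eq_succ (by omega : 0 + 1 ≤ k)
    have hnb := supNorm_sub_le_nbr (x' := x'.1) hxe
    have he1 : Real.exp (-(r * supNorm (xe.1 - x'.1))) ≤ Real.exp r * Real.exp (-(r * supNorm (x.1 - x'.1))) := by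
      rw [← Real.exp_add]
      exact Real.exp_le_exp.2 (by nlinarith)
    have hexp : Real.exp (-(r * supNorm (x.1 - x'.1)))
        ≤ Real.exp (-(min (min (min κ κ') δ / 2) r * supNorm (x.1 - x'.1))) :=
      Real.exp_le_exp.2 (by nlinarith [min_le_right (min (min κ κ') δ / 2) r])
    have heq : (((ℓ + 1) ^ k : ℕ) : ℝ) * ((sc ℓ k 1 ^ 2)⁻¹ * C₀ * (Real.exp r + 1))
        = C₀ * (Real.exp r + 1) * ((ℓ : ℝ) + 1) ^ 2 * (sc ℓ k 0)⁻¹ := by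
      rw [Lk_eq_sc_zero, hs0]
      have := (sc_pos ℓ k 1).ne'
      field_simp
    have hs0i : 0 ≤ (sc ℓ k 0)⁻¹ := (inv_pos.2 (sc_pos ℓ k 0)).le
    calc (((ℓ + 1) ^ k : ℕ) : ℝ) * |Gfine ℓ k M 1 a m2 xe x' - Gfine ℓ k M 1 a m2 x x'|
        ≤ (((ℓ + 1) ^ k : ℕ) : ℝ) * (|Gfine ℓ k M 1 a m2 xe x'| + |Gfine ℓ k M 1 a m2 x x'|) :=
          mul_le_mul_of_nonneg_left (abs_sub _ _) hLk.le
      _ ≤ (((ℓ + 1) ^ k : ℕ) : ℝ) * ((sc ℓ k 1 ^ 2)⁻¹ * C₀ * (Real.exp r * Real.exp (-(r * supNorm (x.1 - x'.1))))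
            + (sc ℓ k 1 ^ 2)⁻¹ * C₀ * Real.exp (-(r * supNorm (x.1 - x'.1)))) := by
          refine mul_le_mul_of_nonneg_left (add_le_add (g1.trans ?_) g2) hLk.le
          exact mul_le_mul_of_nonneg_left he1 (mul_nonneg hs1i hC₀.le)
      _ = (((ℓ + 1) ^ k : ℕ) : ℝ) * ((sc ℓ k 1 ^ 2)⁻¹ * C₀ * (Real.exp r + 1))
            * Real.exp (-(r * supNorm (x.1 - x'.1))) := by ring
      _ = C₀ * (Real.exp r + 1) * ((ℓ : ℝ) + 1) ^ 2 * (sc ℓ k 0)⁻¹ * Real.exp (-(r * supNorm (x.1 - x'.1))) := by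
          rw [heq]
      _ ≤ C₀ * (Real.exp r + 1) * ((ℓ : ℝ) + 1) ^ 2 * (sc ℓ k 0)⁻¹
            * Real.exp (-(min (min (min κ κ') δ / 2) r * supNorm (x.1 - x'.1))) :=
          mul_le_mul_of_nonneg_left hexp (mul_nonneg hCzero.le hs0i)
      _ ≤ _ := by
          refine mul_le_mul_of_nonneg_right (mul_le_mul_of_nonneg_right (by linarith) hs0i) (Real.exp_pos _).le
  · -- `1 ≤ j ≤ k − 1`: the differenced `α_j²·A_jC_jB_j`
    have hj : j + 1 ≤ k := by omega
    obtain ⟨hw1, hw2, hapos⟩ := aSeq_window hℓ ha h1 h2 hj1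
    have hs : 0 < sc ℓ k j ^ 2 := pow_pos (sc_pos ℓ k j) 2
    have hsi : 0 < (sc ℓ k j ^ 2)⁻¹ := inv_pos.2 hs
    have hs1i : 0 < (sc ℓ k j)⁻¹ := inv_pos.2 (sc_pos ℓ k j)
    have hsc0 : sc ℓ k j ≠ 0 := (sc_pos ℓ k j).ne'
    have hm' : 0 ≤ m2 / sc ℓ k j ^ 2 := div_nonneg h3 hs.le
    have hm'' : m2 / sc ℓ k j ^ 2 ≤ m2plus := (div_le_self h3 (one_le_pow₀ (one_le_sc ℓ k j))).trans h4
    have hb1 : 1 ≤ bj ℓ j := bj_pos ℓ j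
    have hbR : (0 : ℝ) < ((bj ℓ j : ℕ) : ℝ) := by positivity
    have hbD : (0 : ℝ) < ((bj ℓ j : ℕ) : ℝ) ^ (d + 1) := by positivity
    -- the differenced row of `A_j`, scaled by `L^k`
    have hg : ∀ (y : ↥(boxDom (Mj ℓ k M j))),
        |(((ℓ + 1) ^ k : ℕ) : ℝ) * (Amat ℓ k M j a m2 xe y - Amat ℓ k M j a m2 x y)|
          ≤ (sc ℓ k j)⁻¹ * C' * Real.exp (-(min κ κ' * supNorm (blk (bj ℓ j) x.1 - y.1))) := by
      intro y
      have hAd : Amat ℓ k M j a m2 xe y - Amat ℓ k M j a m2 x y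
          = ∑ x'', (if blk (bj ℓ j) x''.1 = y.1 then Gfine ℓ k M j a m2 xe x'' - Gfine ℓ k M j a m2 x x''
              else 0) := by
        simp only [Amat, Matrix.mul_apply, QksM, Matrix.of_apply, mul_ite, mul_one, mul_zero]
        exact sum_ite_sub _ _ _ _
      rw [hAd]
      refine (hRD k j hj1 hj a m2 h1 h2 h3 h4 M hM μ x xe hxe y.1 y.2).trans ?_
      exact mul_le_mul_of_nonneg_left (exp_rate_mono (min_le_right κ κ') (supNorm_nonneg _))
        (mul_nonneg hs1i.le hC')
    have hB : ∀ (y' : ↥(boxDom (Mj ℓ k M j))),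
        |Bmat ℓ k M j a m2 y' x'| ≤ ((((bj ℓ j : ℕ) : ℝ)) ^ (d + 1))⁻¹ * ((sc ℓ k j ^ 2)⁻¹ * C₁)
          * Real.exp (-(min κ κ' * supNorm (blk (bj ℓ j) x'.1 - y'.1))) := by
      intro y'
      have hBe : Bmat ℓ k M j a m2 y' x' = ((((bj ℓ j : ℕ) : ℝ)) ^ (d + 1))⁻¹ *
          ∑ w, (if blk (bj ℓ j) w.1 = y'.1 then Gfine ℓ k M j a m2 x' w else 0) := by
        simp only [Bmat, Matrix.mul_apply, QkM, Matrix.of_apply, Finset.mul_sum]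
        refine Finset.sum_congr rfl fun w _ => ?_
        split_ifs with hw
        · rw [(Gfine_isSymm ℓ k M j a m2).apply x' w]
        · rw [zero_mul, mul_zero]
      rw [hBe, abs_mul, abs_of_pos (inv_pos.2 hbD), mul_assoc]
      refine mul_le_mul_of_nonneg_left ((hR k j hj1 hj a m2 h1 h2 h3 h4 M hM x' y'.1 y'.2).trans ?_)
        (inv_pos.2 hbD).le
      exact mul_le_mul_of_nonneg_left (exp_rate_mono (min_le_left κ κ') (supNorm_nonneg _))
        (mul_nonneg hsi.le hC₁)
    have hC : ∀ (y y' : ↥(boxDom (Mj ℓ k M j))),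
        |Cmat ℓ k M j a m2 y y'| ≤ (sc ℓ k j ^ 2)⁻¹ * c₂ * Real.exp (-(δ * supNorm (y.1 - y'.1))) := by
      intro y y'
      have h := (hCov (bj ℓ j) hb1 _ _ a hw1 hw2 hm' hm'' h1 h2 (Mp ℓ k M j) (Mp_pos hM)).2 y y'
      rw [Cmat, Matrix.smul_apply, smul_eq_mul, abs_mul, abs_of_pos hsi, mul_assoc]
      exact mul_le_mul_of_nonneg_left h hsi.le
    -- the pointwise triple-product estimate for the differenced row
    have key := abs_sum2_le (N := Mj ℓ k M j) ⟨blk (bj ℓ j) x.1, blk_bj_mem hj M x⟩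
      ⟨blk (bj ℓ j) x'.1, blk_bj_mem hj M x'⟩
      (fun y => (((ℓ + 1) ^ k : ℕ) : ℝ) * (Amat ℓ k M j a m2 xe y - Amat ℓ k M j a m2 x y))
      (fun y' => Bmat ℓ k M j a m2 y' x') (Cmat ℓ k M j a m2) (mul_nonneg hs1i.le hC')
      (mul_nonneg hsi.le hc₂.le) (mul_nonneg (inv_pos.2 hbD).le (mul_nonneg hsi.le hC₁)) hκ₀ hδ hg hC hB
    rw [← mul3_row_sub] at key
    have hα : αj a ℓ k j ^ 2 ≤ aplus ^ 2 * (sc ℓ k j ^ 2) ^ 2 := by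
      unfold αj
      rw [mul_pow]
      exact mul_le_mul_of_nonneg_right (pow_le_pow_left₀ hapos.le hw2 2) (by positivity)
    have hE := exp_blk_le (δ₁ := min (min (min κ κ') δ / 2) r) hρ0.le (min_le_left _ _) hbR hn0
      (supNorm_sub_le_blk hb1 x.1 x'.1)
    have hP0 : 0 ≤ (sc ℓ k j)⁻¹ * C' * ((sc ℓ k j ^ 2)⁻¹ * c₂)
        * (((((bj ℓ j : ℕ) : ℝ)) ^ (d + 1))⁻¹ * ((sc ℓ k j ^ 2)⁻¹ * C₁))
        * (latticeConst (d + 1) (min κ κ' / 2) * latticeConst (d + 1) (δ / 2)) :=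
      mul_nonneg (mul_nonneg (mul_nonneg (mul_nonneg hs1i.le hC') (mul_nonneg hsi.le hc₂.le))
        (mul_nonneg (inv_pos.2 hbD).le (mul_nonneg hsi.le hC₁))) (mul_nonneg hKκ hKδ)
    have hsplit : (((ℓ + 1) ^ k : ℕ) : ℝ) * |piece ℓ k M j a m2 xe x' - piece ℓ k M j a m2 x x'|
        = αj a ℓ k j ^ 2 * |(((ℓ + 1) ^ k : ℕ) : ℝ) *
            ((Amat ℓ k M j a m2 * Cmat ℓ k M j a m2 * Bmat ℓ k M j a m2) xe x'
              - (Amat ℓ k M j a m2 * Cmat ℓ k M j a m2 * Bmat ℓ k M j a m2) x x')| := by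
      rw [piece_eq_ACB hℓ hj1 hj hM ha0 h3, Matrix.smul_apply, Matrix.smul_apply, smul_eq_mul, smul_eq_mul,
        ← mul_sub, abs_mul, abs_of_nonneg (sq_nonneg _), abs_mul, abs_of_pos hLk]
      ring
    rw [hsplit]
    calc αj a ℓ k j ^ 2 * |(((ℓ + 1) ^ k : ℕ) : ℝ) *
            ((Amat ℓ k M j a m2 * Cmat ℓ k M j a m2 * Bmat ℓ k M j a m2) xe x'
              - (Amat ℓ k M j a m2 * Cmat ℓ k M j a m2 * Bmat ℓ k M j a m2) x x')|
        ≤ (aplus ^ 2 * (sc ℓ k j ^ 2) ^ 2) *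
            ((sc ℓ k j)⁻¹ * C' * ((sc ℓ k j ^ 2)⁻¹ * c₂)
              * (((((bj ℓ j : ℕ) : ℝ)) ^ (d + 1))⁻¹ * ((sc ℓ k j ^ 2)⁻¹ * C₁))
              * (latticeConst (d + 1) (min κ κ' / 2) * latticeConst (d + 1) (δ / 2))
              * (Real.exp (min (min κ κ') δ / 2)
                  * Real.exp (-(min (min (min κ κ') δ / 2) r * supNorm (x.1 - x'.1) / ((bj ℓ j : ℕ) : ℝ))))) :=
          mul_le_mul hα (key.trans (mul_le_mul_of_nonneg_left hE hP0)) (abs_nonneg _) (by positivity)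
      _ = aplus ^ 2 * (C' * c₂ * C₁) * (latticeConst (d + 1) (min κ κ' / 2) * latticeConst (d + 1) (δ / 2))
            * Real.exp (min (min κ κ') δ / 2)
            * ((((bj ℓ j : ℕ) : ℝ) ^ (d + 1))⁻¹ * (sc ℓ k j)⁻¹)
            * Real.exp (-(min (min (min κ κ') δ / 2) r * supNorm (x.1 - x'.1) / ((bj ℓ j : ℕ) : ℝ))) := by
          field_simp
      _ ≤ _ := by
          refine mul_le_mul_of_nonneg_right (mul_le_mul_of_nonneg_right (by linarith) ?_) (Real.exp_pos _).le
          exact mul_nonneg (inv_pos.2 hbD).le hs1i.le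

/-! ## §5 The concrete carrier of B3 (2.5)/(2.10)–(2.12) for the model instance, and `Ineq210` DISCHARGED -/

/-- kernel: `(s⁻¹)^{2−n} = s^n·s^{−2}` (real exponent). [folklore] -/
private theorem inv_rpow_two_sub {s : ℝ} (hs : 0 < s) (n : ℕ) :
    (s⁻¹) ^ ((2 : ℝ) - (n : ℝ)) = s ^ n * (s ^ 2)⁻¹ := by
  rw [Real.inv_rpow hs.le, Real.rpow_sub hs, Real.rpow_two, Real.rpow_natCast, inv_div, div_eq_mul_inv]

/-- kernel: `(s⁻¹)^{1−n} = s^n·s^{−1}` (real exponent). [folklore] -/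
private theorem inv_rpow_one_sub {s : ℝ} (hs : 0 < s) (n : ℕ) :
    (s⁻¹) ^ ((1 : ℝ) - (n : ℝ)) = s ^ n * s⁻¹ := by
  rw [Real.inv_rpow hs.le, Real.rpow_sub hs, Real.rpow_one, Real.rpow_natCast, inv_div, div_eq_mul_inv]

/-- **The concrete carrier of (2.5), (2.10)–(2.12) for the MODEL INSTANCE `A = B̃ = 0`, `Ω = □ = Π_μ[0, M_μ)`** at
scale `k` (`η = L^{−k}`, `L = ℓ + 1`, window point `(a, m²)`): `Site` = the fine box `□ ∩ ηℤ^{d+1}` in lattice units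
(`B4Reflection242.boxDom (L^k·M)`), `dist(x,x′) = η|x − x′|_∞` (the print's `|x − x′|`, sup norm), `L`, `η`, `d ↦ d + 1`;
the (2.10) kernels in the PRINT'S `η^d`-normalisation (`(Gf)(x) = Σ_{x′} η^{d}G(x,x′)f(x′)`, so `G^η = η^{−(d+1)}·𝒢` for the
counting-normalised matrices `𝒢` of `B4Thm110ZeroBox`): `absG j x x′ = η^{−(d+1)}|G^η_{(j)}(x,x′)|` with `G^η_{(j)} = piece j`
((2.6); `0` for `j ≥ k`), `absDG j μ x x′ = η^{−(d+1)}·|(D^η_{0,μ}G^η_{(j)})(x,x′)| = η^{−(d+1)}·η^{−1}|G_{(j)}(x+ηe_μ,x′) −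
G_{(j)}(x,x′)|` when the bond `⟨x, x+ηe_μ⟩` lies in `□` (Neumann: (1.3) of [B4] sums over bonds `b ⊂ Ω`), `0` otherwise.
DECLARED DIVERGENCE (F7): the fields of the carrier that enter only (2.5), (2.11), (2.12) (`Bond`, `LocFn`, `dist2`,
`distBlock`, `distSupp`, `distΩ₂`, `eRun`, `pRun`, `holderDiff`, `absGavg`, `normDeltaG`, `norm116`) are NOT MODELLED here
(set to `Unit`/`0`); accordingly NOTHING is claimed about `Ineq25`, `Ineq211`, `Ineq212` of this instance (they are
vacuous for it) — only `Ineq210` (`ineq210_zeroBox`). [cite: Balaban1983Higgs3, (2.6) p.424, (2.10) p.426] -/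
def zeroBoxKernels (ℓ k : ℕ) (hℓ : 1 ≤ ℓ) (M : Fin (d + 1) → ℕ) (a m2 : ℝ) : ScaledKernels where
  Site := ↥(boxDom (Nf ℓ k M))
  Bond := Unit
  Dir := Fin (d + 1)
  LocFn := Unit
  dist x x' := supNorm (x.1 - x'.1) / (((ℓ + 1) ^ k : ℕ) : ℝ)
  dist2 _ _ _ := 0
  distBlock _ _ _ := 0
  distSupp _ _ := 0
  distΩ₂ := 0
  L := (ℓ : ℝ) + 1
  η := ((((ℓ + 1) ^ k : ℕ) : ℝ))⁻¹
  d := d + 1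
  eRun := 0
  pRun := 0
  one_lt_L := one_lt_L_real hℓ
  η_pos := inv_pos.2 (by positivity)
  absG j x x' := ((((ℓ + 1) ^ k : ℕ) : ℝ)) ^ (d + 1) * |piece ℓ k M j a m2 x x'|
  absDG j μ x x' :=
    if h : x.1 + Pi.single μ 1 ∈ boxDom (Nf ℓ k M) then
      ((((ℓ + 1) ^ k : ℕ) : ℝ)) ^ (d + 1)
        * (((((ℓ + 1) ^ k : ℕ) : ℝ)) * |piece ℓ k M j a m2 ⟨x.1 + Pi.single μ 1, h⟩ x' - piece ℓ k M j a m2 x x'|)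
    else 0
  holderDiff _ _ _ _ _ := 0
  absGavg _ _ _ := 0
  normDeltaG _ _ _ := 0
  norm116 _ _ _ _ _ := 0

section Carrier

variable {ℓ k : ℕ} {hℓ : 1 ≤ ℓ} {M : Fin (d + 1) → ℕ} {a m2 : ℝ}

/-- the length scale `L^jη = s_j^{-1}` of the `j`-th piece (`j ≤ k`). [cite: Balaban1983Higgs3, (2.10) p.426] -/
theorem scale_eq {j : ℕ} (hj : j ≤ k) : (zeroBoxKernels ℓ k hℓ M a m2).scale j = (sc ℓ k j)⁻¹ := by
  show ((ℓ : ℝ) + 1) ^ j * ((((ℓ + 1) ^ k : ℕ) : ℝ))⁻¹ = (sc ℓ k j)⁻¹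
  have h := sc_mul_bj (ℓ := ℓ) hj
  rw [bj_cast] at h
  have hs := (sc_pos ℓ k j).ne'
  have hL : (0 : ℝ) < ((ℓ : ℝ) + 1) ^ j := by positivity
  push_cast
  rw [← h]
  field_simp

/-- the length scales are positive. [cite: Balaban1983Higgs3, (2.10) p.426] -/
theorem scale_pos (j : ℕ) : 0 < (zeroBoxKernels ℓ k hℓ M a m2).scale j := by
  show 0 < ((ℓ : ℝ) + 1) ^ j * ((((ℓ + 1) ^ k : ℕ) : ℝ))⁻¹
  positivity

/-- `(L^jη)^{-1}·dist(x,x′) = |x − x′|_∞/L^j` (lattice units). [cite: Balaban1983Higgs3, (2.10) p.426] -/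
theorem scale_inv_mul_dist {j : ℕ} (hj : j ≤ k) (x x' : ↥(boxDom (Nf ℓ k M))) :
    ((zeroBoxKernels ℓ k hℓ M a m2).scale j)⁻¹ * (zeroBoxKernels ℓ k hℓ M a m2).dist x x'
      = supNorm (x.1 - x'.1) / ((bj ℓ j : ℕ) : ℝ) := by
  rw [scale_eq hj, inv_inv]
  show sc ℓ k j * (supNorm (x.1 - x'.1) / (((ℓ + 1) ^ k : ℕ) : ℝ)) = supNorm (x.1 - x'.1) / ((bj ℓ j : ℕ) : ℝ)
  have h := sc_mul_bj (ℓ := ℓ) hj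
  rw [bj_cast] at h
  have hs := (sc_pos ℓ k j).ne'
  have hL : (0 : ℝ) < ((ℓ : ℝ) + 1) ^ j := by positivity
  push_cast [bj_cast]
  rw [← h]
  field_simp

/-- kernel: `η^{−(d+1)}·L^{−j(d+1)} = s_j^{d+1}` (`L^k = s_jb_j`). [folklore] -/
private theorem Lk_pow_mul_inv_bj_pow {j : ℕ} (hj : j ≤ k) :
    ((((ℓ + 1) ^ k : ℕ) : ℝ)) ^ (d + 1) * ((((bj ℓ j : ℕ) : ℝ)) ^ (d + 1))⁻¹ = sc ℓ k j ^ (d + 1) := by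
  have h := sc_mul_bj (ℓ := ℓ) hj
  rw [bj_cast] at h
  have hL : (0 : ℝ) < ((ℓ : ℝ) + 1) ^ j := by positivity
  push_cast [bj_cast]
  rw [← h, mul_pow]
  field_simp

end Carrier

/-- **B3 (2.10) p. 426 [PDF 16] — `ScaledKernels.Ineq210 δ₁ C` DISCHARGED for the model instance `A = B̃ = 0`, `Ω = □`.**
Verbatim (p. 426): *"For the propagators G^η_{(j)} we apply the inequality
|G^η_{(j)}(Ω, B̃; x, x′)| ≤ O(1)(L^jη)^{−d+2}e^{−δ₁(L^jη)^{−1}|x−x′|}, (2.10) and if the propagator is differentiated, then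
for each differentiation, there is an additional factor (L^jη)^{−1} on the right side. … They all are obtained by rescaling
from the η-lattice to the L^{−j}-lattice and application of Propositions I.2.1 and I.2.3."*  HERE: there are `δ₁ > 0` and
`C = O(1) > 0` depending only on the dimension `d + 1`, `L = ℓ + 1 ≥ 2` and the window `[a₋,a₊] × [0,m²₊]` of the running
constants such that for EVERY scale `k ≥ 1` (`η = L^{−k}`), every `(a, m²)` in the window and every rectangular parallelepiped
`□ = Π_μ[0, M_μ)` (`M_μ ≥ 1`), the carrier `zeroBoxKernels` of the scale pieces `G^η_{(j)}(□, 0)`, `0 ≤ j ≤ k − 1`, of the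
decomposition (2.6) of `G_k(□, 0) = (−Δ^{η,N}_□ + m² + a_kP_k)^{−1}` (`sum_piece_eq_inv`) satisfies `Ineq210 δ₁ C`: the value
clause with `(L^jη)^{2−(d+1)}` and the once-differentiated clause with `(L^jη)^{1−(d+1)}`, decay `e^{−δ₁(L^jη)^{−1}dist(x,x′)}`,
uniformly in `k` and `□`.  HONEST SCOPE: (i) `A = B̃ = 0`, one component, `Ω = □` a box of unit blocks (Neumann conditions) —
not general unions of big blocks `Ω ⊂ T_η` and not the torus; (ii) the derivative is the forward covariant (= plain, `U ≡ 1`)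
difference in the ROW variable along bonds of `□`; (iii) sup norm for `|x − x′|` (the Euclidean form follows with
`δ₁/√(d+1)`); (iv) constants existential, depending on `d`, `L` and the window (print: O(1), δ₁ absolute); (v) ROUTE = the
print's («rescaling … and application of Propositions I.2.1 and I.2.3» = [B4] Theorem / Prop. 2.3), carried out through the
kernel-proved `A = 0` box forms of [B4] (2.34)/(2.35)/(2.37) (`abs_piece_le`, `abs_pieceDiff_le`).
[cite: Balaban1983Higgs3, (2.10) p.426] -/
theorem ineq210_zeroBox (d ℓ : ℕ) (hℓ : 1 ≤ ℓ) (amin aplus m2plus : ℝ) (ha : 0 < amin) :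
    ∃ δ₁ C : ℝ, 0 < δ₁ ∧ 0 < C ∧ ∀ (k : ℕ), 1 ≤ k → ∀ (a m2 : ℝ), amin ≤ a → a ≤ aplus → 0 ≤ m2 →
      m2 ≤ m2plus → ∀ (M : Fin (d + 1) → ℕ), (∀ i, 1 ≤ M i) →
        (zeroBoxKernels ℓ k hℓ M a m2).Ineq210 δ₁ C := by
  obtain ⟨δv, Cv, hδv, hCv, hV⟩ := abs_piece_le d ℓ hℓ amin aplus m2plus ha
  obtain ⟨δd, Cd, hδd, hCd, hD⟩ := abs_pieceDiff_le d ℓ hℓ amin aplus m2plus ha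
  refine ⟨min δv δd, Cv + Cd, lt_min hδv hδd, by linarith, ?_⟩
  intro k hk a m2 h1 h2 h3 h4 M hM j x x'
  change ↥(boxDom (Nf ℓ k M)) at x x'
  have hLk : (0 : ℝ) < (((ℓ + 1) ^ k : ℕ) : ℝ) := by positivity
  have hn0 : 0 ≤ supNorm (x.1 - x'.1) := supNorm_nonneg _
  have hsp : 0 < (zeroBoxKernels ℓ k hℓ M a m2).scale j := scale_pos j
  have hSd : ((zeroBoxKernels ℓ k hℓ M a m2).d : ℝ) = ((d + 1 : ℕ) : ℝ) := rfl
  have hmin0 : 0 ≤ min δv δd := (lt_min hδv hδd).le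
  have hRHS2 : 0 ≤ (Cv + Cd) * (zeroBoxKernels ℓ k hℓ M a m2).scale j ^ (2 - ((zeroBoxKernels ℓ k hℓ M a m2).d : ℝ))
      * Real.exp (-(min δv δd * ((zeroBoxKernels ℓ k hℓ M a m2).scale j)⁻¹ * (zeroBoxKernels ℓ k hℓ M a m2).dist x x')) :=
    mul_nonneg (mul_nonneg (by linarith) (Real.rpow_pos_of_pos hsp _).le) (Real.exp_pos _).le
  have hRHS1 : 0 ≤ (Cv + Cd) * (zeroBoxKernels ℓ k hℓ M a m2).scale j ^ (1 - ((zeroBoxKernels ℓ k hℓ M a m2).d : ℝ))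
      * Real.exp (-(min δv δd * ((zeroBoxKernels ℓ k hℓ M a m2).scale j)⁻¹ * (zeroBoxKernels ℓ k hℓ M a m2).dist x x')) :=
    mul_nonneg (mul_nonneg (by linarith) (Real.rpow_pos_of_pos hsp _).le) (Real.exp_pos _).le
  rcases Nat.lt_or_ge j k with hjk | hkj
  · -- the pieces `j < k`
    have hj : j ≤ k := hjk.le
    have hb : (0 : ℝ) < ((bj ℓ j : ℕ) : ℝ) := by have := bj_pos ℓ j; positivity
    have hexp : Real.exp (-(min δv δd * ((zeroBoxKernels ℓ k hℓ M a m2).scale j)⁻¹ * (zeroBoxKernels ℓ k hℓ M a m2).dist x x'))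
        = Real.exp (-(min δv δd * supNorm (x.1 - x'.1) / ((bj ℓ j : ℕ) : ℝ))) := by
      rw [mul_assoc, scale_inv_mul_dist hj, mul_div_assoc]
    have hmono : ∀ {δ' : ℝ}, min δv δd ≤ δ' →
        Real.exp (-(δ' * supNorm (x.1 - x'.1) / ((bj ℓ j : ℕ) : ℝ)))
          ≤ Real.exp (-(min δv δd * supNorm (x.1 - x'.1) / ((bj ℓ j : ℕ) : ℝ))) := by
      intro δ' hle
      apply Real.exp_le_exp.2
      rw [mul_div_assoc, mul_div_assoc]
      nlinarith [div_nonneg hn0 hb.le]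
    refine ⟨?_, fun μ => ?_⟩
    · -- value clause
      have hv := hV k hk j hjk a m2 h1 h2 h3 h4 M hM x x'
      rw [hexp, scale_eq hj, hSd, inv_rpow_two_sub (sc_pos ℓ k j)]
      show ((((ℓ + 1) ^ k : ℕ) : ℝ)) ^ (d + 1) * |piece ℓ k M j a m2 x x'| ≤ _
      calc ((((ℓ + 1) ^ k : ℕ) : ℝ)) ^ (d + 1) * |piece ℓ k M j a m2 x x'|
          ≤ ((((ℓ + 1) ^ k : ℕ) : ℝ)) ^ (d + 1) * (Cv * ((((bj ℓ j : ℕ) : ℝ) ^ (d + 1))⁻¹ * (sc ℓ k j ^ 2)⁻¹)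
              * Real.exp (-(δv * supNorm (x.1 - x'.1) / ((bj ℓ j : ℕ) : ℝ)))) :=
            mul_le_mul_of_nonneg_left hv (by positivity)
        _ = Cv * (sc ℓ k j ^ (d + 1) * (sc ℓ k j ^ 2)⁻¹)
              * Real.exp (-(δv * supNorm (x.1 - x'.1) / ((bj ℓ j : ℕ) : ℝ))) := by
            rw [← Lk_pow_mul_inv_bj_pow (d := d) hj]; ring
        _ ≤ (Cv + Cd) * (sc ℓ k j ^ (d + 1) * (sc ℓ k j ^ 2)⁻¹)
              * Real.exp (-(min δv δd * supNorm (x.1 - x'.1) / ((bj ℓ j : ℕ) : ℝ))) := by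
            have hq : 0 ≤ sc ℓ k j ^ (d + 1) * (sc ℓ k j ^ 2)⁻¹ := by
              have := sc_pos ℓ k j; positivity
            exact mul_le_mul (mul_le_mul_of_nonneg_right (by linarith) hq) (hmono (min_le_left _ _))
              (Real.exp_pos _).le (mul_nonneg (by linarith) hq)
    · -- derivative clause
      change Fin (d + 1) at μ
      by_cases hmem : x.1 + Pi.single μ 1 ∈ boxDom (Nf ℓ k M)
      · have hd := hD k hk j hjk a m2 h1 h2 h3 h4 M hM μ x ⟨x.1 + Pi.single μ 1, hmem⟩ rfl x'
        rw [hexp, scale_eq hj, hSd, inv_rpow_one_sub (sc_pos ℓ k j)]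
        show (if h : x.1 + Pi.single μ 1 ∈ boxDom (Nf ℓ k M) then
          ((((ℓ + 1) ^ k : ℕ) : ℝ)) ^ (d + 1)
            * (((((ℓ + 1) ^ k : ℕ) : ℝ)) * |piece ℓ k M j a m2 ⟨x.1 + Pi.single μ 1, h⟩ x' - piece ℓ k M j a m2 x x'|)
          else 0) ≤ _
        rw [dif_pos hmem]
        calc ((((ℓ + 1) ^ k : ℕ) : ℝ)) ^ (d + 1)
              * (((((ℓ + 1) ^ k : ℕ) : ℝ)) * |piece ℓ k M j a m2 ⟨x.1 + Pi.single μ 1, hmem⟩ x' - piece ℓ k M j a m2 x x'|)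
            ≤ ((((ℓ + 1) ^ k : ℕ) : ℝ)) ^ (d + 1) * (Cd * ((((bj ℓ j : ℕ) : ℝ) ^ (d + 1))⁻¹ * (sc ℓ k j)⁻¹)
                * Real.exp (-(δd * supNorm (x.1 - x'.1) / ((bj ℓ j : ℕ) : ℝ)))) :=
              mul_le_mul_of_nonneg_left hd (by positivity)
          _ = Cd * (sc ℓ k j ^ (d + 1) * (sc ℓ k j)⁻¹)
                * Real.exp (-(δd * supNorm (x.1 - x'.1) / ((bj ℓ j : ℕ) : ℝ))) := by
              rw [← Lk_pow_mul_inv_bj_pow (d := d) hj]; ring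
          _ ≤ (Cv + Cd) * (sc ℓ k j ^ (d + 1) * (sc ℓ k j)⁻¹)
                * Real.exp (-(min δv δd * supNorm (x.1 - x'.1) / ((bj ℓ j : ℕ) : ℝ))) := by
              have hq : 0 ≤ sc ℓ k j ^ (d + 1) * (sc ℓ k j)⁻¹ := by
                have := sc_pos ℓ k j; positivity
              exact mul_le_mul (mul_le_mul_of_nonneg_right (by linarith) hq) (hmono (min_le_right _ _))
                (Real.exp_pos _).le (mul_nonneg (by linarith) hq)
      · show (if h : x.1 + Pi.single μ 1 ∈ boxDom (Nf ℓ k M) then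
          ((((ℓ + 1) ^ k : ℕ) : ℝ)) ^ (d + 1)
            * (((((ℓ + 1) ^ k : ℕ) : ℝ)) * |piece ℓ k M j a m2 ⟨x.1 + Pi.single μ 1, h⟩ x' - piece ℓ k M j a m2 x x'|)
          else 0) ≤ _
        rw [dif_neg hmem]
        exact hRHS1
  · -- no pieces for `j ≥ k`
    have hj1 : 1 ≤ j := le_trans hk hkj
    have hp : piece ℓ k M j a m2 = 0 := piece_of_le hj1 hkj
    refine ⟨?_, fun μ => ?_⟩
    · show ((((ℓ + 1) ^ k : ℕ) : ℝ)) ^ (d + 1) * |piece ℓ k M j a m2 x x'| ≤ _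
      rw [hp, Matrix.zero_apply, abs_zero, mul_zero]
      exact hRHS2
    · change Fin (d + 1) at μ
      show (if h : x.1 + Pi.single μ 1 ∈ boxDom (Nf ℓ k M) then
          ((((ℓ + 1) ^ k : ℕ) : ℝ)) ^ (d + 1)
            * (((((ℓ + 1) ^ k : ℕ) : ℝ)) * |piece ℓ k M j a m2 ⟨x.1 + Pi.single μ 1, h⟩ x' - piece ℓ k M j a m2 x x'|)
          else 0) ≤ _
      split_ifs with hmem
      · rw [hp, Matrix.zero_apply, Matrix.zero_apply, sub_zero, abs_zero, mul_zero, mul_zero]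
        exact hRHS1
      · exact hRHS1

/-! ## §6 Non-vacuity: the binders are inhabited (`d + 1 = 3`, `L = 2`, window `a ∈ [1/2, 2]`, `m² ∈ [0, 1]`,
`k = 1`, the unit cube, `a = 1`, `m² = 0`) -/

/-- **Non-vacuity witness**: (2.10) holds, with the constants of `ineq210_zeroBox` for `d + 1 = 3`, `L = 2` and the window
`[1/2, 2] × [0, 1]`, for the instance `k = 1`, `□ = [0,1)³` (two fine points per side), `a = 1`, `m² = 0`.
[cite: Balaban1983Higgs3, (2.10) p.426] -/
theorem ineq210_zeroBox_witness :
    ∃ δ₁ C : ℝ, 0 < δ₁ ∧ 0 < C ∧ (zeroBoxKernels (d := 2) 1 1 le_rfl (fun _ => 1) 1 0).Ineq210 δ₁ C := by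
  obtain ⟨δ₁, C, hδ, hC, h⟩ := ineq210_zeroBox 2 1 le_rfl (1 / 2) 2 1 (by norm_num)
  exact ⟨δ₁, C, hδ, hC, h 1 le_rfl 1 0 (by norm_num) (by norm_num) le_rfl (by norm_num) _ fun _ => le_rfl⟩

end

end Literature.MathematicalPhysics.QuantumFieldTheory.Balaban1983to89.B3Ineq210ZeroBox
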